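import Summits.QuantumFields.YangMills.Theorems.SwapVirialDeficitBlowUpVirialGoodHubPowers
import Summits.QuantumFields.YangMills.Theorems.SwapVirialDeficitSwapRingLargeFieldShare
import HarnessLib

/-!
# W5 — the FAR REGION of the sector law: chart sets on which the deficit has a floor `s₀` carry Gibbs share `≤ e^{−bs₀}` (absolute) and
# `≤ e·(C·p·L⁴ℓ/(b·s₀))^p·Z₀(b)` (relative, every `p`); and the pointwise floors that put the far-in-fibre sets there
# (free-hands support of ⟨stmt-QuantumFields-24197⟩; brick W5 of LEAD ym-line-sfw-p2 g97's steep-window Morse–Bott plan, memo sfw-p2-g97-memo-24197-steep-window-morse-bott.md §1 (B-far))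

(B-far) of the LEAD memo: off the fibre ball `{‖y‖ > R}` over the bulk, and on `{F̂ > F̂_max}` anywhere, the GLOBAL pointwise inequalities of the tree give a deficit
floor `F̂ ≥ s₀ = poly(L)⁻¹·R²`, so the share is `≤ e^{−bs₀}·(total mass)` — negligible against `b^{−α}e^{C(L)}` on a steep window.  This file provides both halves
in the gnomonic ring chart (`⟪g⟫ := K_L·∫_cone Σ_ε ∫ g·e^{−bF̂₀}·ρ`, principal sector), with no set geometry fixed (W3 will fix the bulk/tip split):

* §1 POINTWISE FLOORS (far in a fibre coordinate ⟹ deficit floor), hub-angle dependence explicit and polynomial: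
  `gnomonicW_ge_of_le_normSq3` (monotonicity of `x ↦ 4x/(1+x)`), ★ `gnoDeficit_ge_of_follower_far` (`r² ≤ |η_f|² ⟹ 4r²/((1+r²)·27648L^{10}) ≤ F̂`, EVERY hub,
  w2's ✓`followersW_le_gnoDeficit`), ★ `gnoDeficit_ge_of_z_far` (`r² ≤ |η_z|² ⟹ 4r²/((1+r²)·7200L⁶) ≤ F̂`, hub `a ≠ 0`, ✓`gnomonicW_z_le`),
  ★ `gnoDeficit_ge_of_y_far` ∕ `gnoDeficit_ge_of_x_far` (transverse part `≥ r²` of the hub-soft letters on a good hub `θ ≤ sin²ψ` resp. `θ ≤ sin²2ψ`: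
  `θ·4r²/((1 + |η|²_{total})·1800L⁶) ≤ F̂` resp. `/7200L⁶`; the axial coordinate enters only through the gnomonic denominator, bounded on the bulk);
* §2 SHARES: ★★ `chartTerm_indicator_le_exp` — for measurable `S ε ⊆ {s₀ ≤ F̂}` (off the null hub): `⟪𝟙_S⟫ ≤ e^{−b·s₀}` (total mass `1`, ✓`gnomonic_total_mass_real`);
  ★★ `chartTerm_indicator_le_exp_mul_laplace` — `⟪𝟙_S⟫ ≤ exp(−b·s₀ + (9L⁴−1)log b + K·L⁴(1+log L))·Z₀(b)` (✓`swap_laplace_floor_uniform`);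
  ★★ `chartTerm_indicator_le_rpow` — `⟪𝟙_S⟫ ≤ e·(C·p·L⁴·(1+log L+log b)/(b·s₀))^p·Z₀(b)` for EVERY `p > 0` (the socket ✓`chartTerm_rpow_apriori` with `g = 𝟙_S ≤ (F̂/s₀)^p`).
On a steep window `b·s₀ ≥ b/poly(L) ≫ L⁴ log b`, either form is `o(b^{−θ})·Z₀` for every `θ`.

HONEST LABEL: bookkeeping on landed pointwise bounds; the bulk/tip SET geometry (W3), the tip (W6) and the assembly (W9) are not here; ⟨24197⟩ ∕ ⟨24196⟩ ∕ ⟨24194⟩ ∕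
⟨24497⟩ OPEN; own crux ⟨22884⟩ OPEN (blocked-on ⟨19935⟩); no crux, rung of record or summit is proved; the Yang–Mills mass gap is NOT proved; no summit is proved by a
line.  THEOREMS ONLY (0 `def`, 0 `sorry`), standard axioms; the series' local `ℍ` instances.  Width seat ym-line-sfw-p2-w3 g65 (cell ym-idea-1, free hands),
`--supports stmt-QuantumFields-24197`.  References: [cite: Luscher1983, §2]; [cite: Griffiths1964]; [folklore].
-/

set_option autoImplicit false
set_option synthInstance.maxSize 1024

noncomputable section

open MeasureTheory Quaternion Set Filter Topology
open scoped Quaternion BigOperators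
open Literature.MathematicalPhysics.QuantumLattice
open Literature.MathematicalPhysics.QuantumFieldTheory hiding SU2
open Summit.QuantumFields.YangMills.Theorems.FemtoTransferGap
open Summit.QuantumFields.YangMills.Theorems.FemtoTransferGap.TT
open Summit.QuantumFields.YangMills.Theorems.VirialFluxGap.RingDeficit
open Summit.QuantumFields.YangMills.Theorems.SwapTwistDeficit.ToronLog (coneMeasure coneConst coneConst_pos isProbabilityMeasure_coneMeasure)
open Summit.QuantumFields.YangMills.Theorems.SwapVirialDeficit.SwapRing
open Summit.QuantumFields.YangMills.Theorems.SwapVirialDeficit.Gnomonic (gnomonicW gnomonicW_nonneg_le normSq3 normSq3_nonneg)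
open Summit.QuantumFields.YangMills.Theorems.SwapVirialDeficit.ZeroModeSigma (ae_ne_zero_coneMeasure)

attribute [local instance] Literature.Analysis.FluidPDE.Tao2016.quatMeasurableSpace
  Literature.Analysis.FluidPDE.Tao2016.quatBorelSpace
  Literature.MathematicalPhysics.QuantumLattice.secondCountableTopology_su2

namespace Summit.QuantumFields.YangMills.Theorems.SwapVirialDeficit.BlowUpRing

variable {L : ℕ} [NeZero L]

/-! ## §1 Pointwise floors: far in a fibre coordinate ⟹ a deficit floor -/

/-- Monotonicity of the weight profile: `r₂ ≤ x`, `0 ≤ r₂` ⟹ `4r₂/(1+r₂) ≤ 4x/(1+x)`. [folklore] -/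
theorem weightProfile_mono {r₂ x : ℝ} (hr : 0 ≤ r₂) (h : r₂ ≤ x) : 4 * r₂ / (1 + r₂) ≤ 4 * x / (1 + x) := by
  have hx : 0 ≤ x := hr.trans h
  rw [div_le_div_iff₀ (by linarith) (by linarith)]
  nlinarith

omit [NeZero L] in
/-- `r₂ ≤ |v|²` ⟹ `4r₂/(1+r₂) ≤ gnomonicW v`. [folklore] -/
theorem gnomonicW_ge_of_le_normSq3 {r₂ : ℝ} (hr : 0 ≤ r₂) {v : Fin 3 → ℝ} (h : r₂ ≤ normSq3 v) : 4 * r₂ / (1 + r₂) ≤ gnomonicW v := by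
  unfold gnomonicW; exact weightProfile_mono hr h

/-- ★ **Far follower ⟹ deficit floor** (EVERY hub): if some follower has `r₂ ≤ |η_f|²` then `4r₂/((1+r₂)·27648·L^{10}) ≤ F̂₀(a,ε,η)`
(w2 g57's ✓`followersW_le_gnoDeficit`: `Σ_f W(η_f) ≤ 27648L^{10}F̂`). [cite: Luscher1983, §2] -/
theorem gnoDeficit_ge_of_follower_far (a : ℍ) (ε : GnoSign L) (η : GnoCoord L) (f : Fol L) {r₂ : ℝ} (hr : 0 ≤ r₂) (h : r₂ ≤ normSq3 (η.2.2 f)) :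
    4 * r₂ / ((1 + r₂) * (27648 * (L : ℝ) ^ 10)) ≤ gnoDeficit (fun _ => false) (fun _ => 1) a ε η := by
  have hL : (0 : ℝ) < L := by exact_mod_cast NeZero.pos L
  have h1 := gnomonicW_ge_of_le_normSq3 hr h
  have h2 : gnomonicW (η.2.2 f) ≤ ∑ f', gnomonicW (η.2.2 f') :=
    Finset.single_le_sum (fun f' _ => (gnomonicW_nonneg_le (η.2.2 f')).1) (Finset.mem_univ f)
  have h3 := followersW_le_gnoDeficit (L := L) a ε η
  have hK : (0 : ℝ) < 27648 * (L : ℝ) ^ 10 := by positivity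
  rw [← div_div, div_le_iff₀ hK]
  calc 4 * r₂ / (1 + r₂) ≤ ∑ f', gnomonicW (η.2.2 f') := h1.trans h2
    _ ≤ 27648 * (L : ℝ) ^ 10 * gnoDeficit (fun _ => false) (fun _ => 1) a ε η := h3
    _ = _ := by ring

/-- ★ **Far `z`-letter ⟹ deficit floor** (hub `a ≠ 0`): `r₂ ≤ |η_z|² ⟹ 4r₂/((1+r₂)·7200L⁶) ≤ F̂₀` (✓`gnomonicW_z_le`). [cite: Luscher1983, §2] -/
theorem gnoDeficit_ge_of_z_far {a : ℍ} (ha : a ≠ 0) (ε : GnoSign L) (η : GnoCoord L) {r₂ : ℝ} (hr : 0 ≤ r₂) (h : r₂ ≤ normSq3 η.2.1) :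
    4 * r₂ / ((1 + r₂) * (7200 * (L : ℝ) ^ 6)) ≤ gnoDeficit (fun _ => false) (fun _ => 1) a ε η := by
  have hL : (0 : ℝ) < L := by exact_mod_cast NeZero.pos L
  have h1 := gnomonicW_ge_of_le_normSq3 hr h
  have h3 : gnomonicW η.2.1 ≤ 7200 * (L : ℝ) ^ 6 * gnoDeficit (fun _ => false) (fun _ => 1) a ε η := gnomonicW_z_le (L := L) ha ε η
  have hK : (0 : ℝ) < 7200 * (L : ℝ) ^ 6 := by positivity
  rw [← div_div, div_le_iff₀ hK]
  calc 4 * r₂ / (1 + r₂) ≤ gnomonicW η.2.1 := h1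
    _ ≤ _ := h3
    _ = _ := by ring

/-- The transverse weight profile: `r₂ ≤ v₁² + v₂²`, `0 ≤ r₂` ⟹ `4r₂/(1 + v₀² + r₂) ≤ gnoWtr v` (the axial coordinate only enters the denominator). [folklore] -/
theorem gnoWtr_ge_of_le_transverse {r₂ : ℝ} (hr : 0 ≤ r₂) (v : Fin 3 → ℝ) (h : r₂ ≤ v 1 ^ 2 + v 2 ^ 2) :
    4 * r₂ / (1 + v 0 ^ 2 + r₂) ≤ gnoWtr v := by
  unfold gnoWtr
  have hs : ∑ i, v i ^ 2 = v 0 ^ 2 + v 1 ^ 2 + v 2 ^ 2 := by rw [Fin.sum_univ_three]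
  rw [hs, div_le_div_iff₀ (by positivity) (by positivity)]
  nlinarith [sq_nonneg (v 0)]

/-- ★ **Far hub-soft letter `y` on a good `y`-hub ⟹ deficit floor**: `θ ≤ sin²ψ = (‖Im a‖/‖a‖)²`, `r₂ ≤ (η_y)₁² + (η_y)₂²` ⟹
`θ·(4r₂/(1 + (η_y)₀² + r₂))/(1800L⁶) ≤ F̂₀` (✓`hubStiff_mul_gnoWtr_y_le`). [cite: Luscher1983, §2] -/
theorem gnoDeficit_ge_of_y_far {a : ℍ} (ha : a ≠ 0) (ε : GnoSign L) (η : GnoCoord L) {θ r₂ : ℝ} (hθa : θ ≤ (‖a‖⁻¹ * ‖a.im‖) ^ 2)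
    (hr : 0 ≤ r₂) (h : r₂ ≤ η.1.2 1 ^ 2 + η.1.2 2 ^ 2) :
    θ * (4 * r₂ / (1 + η.1.2 0 ^ 2 + r₂)) / (1800 * (L : ℝ) ^ 6) ≤ gnoDeficit (fun _ => false) (fun _ => 1) a ε η := by
  have hL : (0 : ℝ) < L := by exact_mod_cast NeZero.pos L
  have h1 := gnoWtr_ge_of_le_transverse hr η.1.2 h
  have hW0 := (gnoWtr_nonneg_le η.1.2).1
  have h3 : (‖a‖⁻¹ * ‖a.im‖) ^ 2 * gnoWtr η.1.2 ≤ 1800 * (L : ℝ) ^ 6 * gnoDeficit (fun _ => false) (fun _ => 1) a ε η :=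
    hubStiff_mul_gnoWtr_y_le (L := L) ha ε η
  have hK : (0 : ℝ) < 1800 * (L : ℝ) ^ 6 := by positivity
  rw [div_le_iff₀ hK]
  have hq : 0 ≤ 4 * r₂ / (1 + η.1.2 0 ^ 2 + r₂) := by positivity
  calc θ * (4 * r₂ / (1 + η.1.2 0 ^ 2 + r₂)) ≤ (‖a‖⁻¹ * ‖a.im‖) ^ 2 * gnoWtr η.1.2 := mul_le_mul hθa h1 hq (by positivity)
    _ ≤ _ := h3
    _ = _ := by ring

/-- ★ **Far hub-soft letter `x` on a good `x`-hub ⟹ deficit floor**: `θ ≤ sin²2ψ = (2(Re a/‖a‖)(‖Im a‖/‖a‖))²`, `r₂ ≤ (η_x)₁² + (η_x)₂²` ⟹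
`θ·(4r₂/(1 + (η_x)₀² + r₂))/(7200L⁶) ≤ F̂₀` (✓`hubStiff_mul_gnoWtr_x_le`). [cite: Luscher1983, §2] -/
theorem gnoDeficit_ge_of_x_far {a : ℍ} (ha : a ≠ 0) (ε : GnoSign L) (η : GnoCoord L) {θ r₂ : ℝ}
    (hθa : θ ≤ (2 * (‖a‖⁻¹ * a.re) * (‖a‖⁻¹ * ‖a.im‖)) ^ 2) (hr : 0 ≤ r₂) (h : r₂ ≤ η.1.1 1 ^ 2 + η.1.1 2 ^ 2) :
    θ * (4 * r₂ / (1 + η.1.1 0 ^ 2 + r₂)) / (7200 * (L : ℝ) ^ 6) ≤ gnoDeficit (fun _ => false) (fun _ => 1) a ε η := by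
  have hL : (0 : ℝ) < L := by exact_mod_cast NeZero.pos L
  have h1 := gnoWtr_ge_of_le_transverse hr η.1.1 h
  have hW0 := (gnoWtr_nonneg_le η.1.1).1
  have h3 : (2 * (‖a‖⁻¹ * a.re) * (‖a‖⁻¹ * ‖a.im‖)) ^ 2 * gnoWtr η.1.1 ≤ 7200 * (L : ℝ) ^ 6 * gnoDeficit (fun _ => false) (fun _ => 1) a ε η :=
    hubStiff_mul_gnoWtr_x_le (L := L) ha ε η
  have hK : (0 : ℝ) < 7200 * (L : ℝ) ^ 6 := by positivity
  rw [div_le_iff₀ hK]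
  have hq : 0 ≤ 4 * r₂ / (1 + η.1.1 0 ^ 2 + r₂) := by positivity
  calc θ * (4 * r₂ / (1 + η.1.1 0 ^ 2 + r₂)) ≤ (2 * (‖a‖⁻¹ * a.re) * (‖a‖⁻¹ * ‖a.im‖)) ^ 2 * gnoWtr η.1.1 := mul_le_mul hθa h1 hq (by positivity)
    _ ≤ _ := h3
    _ = _ := by ring

/-! ## §2 The Gibbs share of a chart set carrying a deficit floor -/

section Share

variable {S : GnoSign L → Set (ℍ × GnoCoord L)} {s₀ b : ℝ}

/-- ★★ **ABSOLUTE SHARE**: measurable chart sets `S ε` on which `s₀ ≤ F̂₀` (off the null hub) have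
`K_L·∫_cone Σ_ε ∫ 𝟙_{S ε}(a,η)·e^{−bF̂₀}·ρ ≤ e^{−b·s₀}` for `b ≥ 0` (total mass `1`, ✓`gnomonic_total_mass_real`). [folklore] -/
theorem chartTerm_indicator_le_exp (hS : ∀ ε, MeasurableSet (S ε))
    (hfloor : ∀ (ε : GnoSign L) (a : ℍ) (η : GnoCoord L), a ≠ 0 → (a, η) ∈ S ε → s₀ ≤ gnoDeficit (fun _ => false) (fun _ => 1) a ε η) (hb : 0 ≤ b) :
    (coneConst ^ 3 / 64 * (1 / (2 * Real.pi ^ 2)) ^ Fintype.card (Fol L)) *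
        ∫ a, (∑ ε : GnoSign L, ∫ η : GnoCoord L, (S ε).indicator (fun _ => (1 : ℝ)) (a, η) *
          Real.exp (-(b * gnoDeficit (fun _ => false) (fun _ => 1) a ε η)) * gnoDensity η) ∂coneMeasure ≤ Real.exp (-(b * s₀)) := by
  haveI := isProbabilityMeasure_coneMeasure
  have hK : (0 : ℝ) ≤ coneConst ^ 3 / 64 * (1 / (2 * Real.pi ^ 2)) ^ Fintype.card (Fol L) := by have := coneConst_pos; positivity
  -- pointwise: `𝟙_S e^{−bF̂} ρ ≤ e^{−bs₀} ρ` off the null hub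
  have hpt : ∀ (ε : GnoSign L) (a : ℍ) (η : GnoCoord L), a ≠ 0 →
      (S ε).indicator (fun _ => (1 : ℝ)) (a, η) * Real.exp (-(b * gnoDeficit (fun _ => false) (fun _ => 1) a ε η)) * gnoDensity η ≤
        Real.exp (-(b * s₀)) * gnoDensity η := by
    intro ε a η ha
    have hρ := (gnoDensity_pos η).le
    by_cases hm : (a, η) ∈ S ε
    · rw [Set.indicator_of_mem hm, one_mul]
      refine mul_le_mul_of_nonneg_right (Real.exp_le_exp.2 ?_) hρ
      have := hfloor ε a η ha hm
      nlinarith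
    · rw [Set.indicator_of_notMem hm, zero_mul, zero_mul]
      positivity
  -- fibrewise and then on the cone
  have hfib : ∀ᵐ a ∂coneMeasure, (∑ ε : GnoSign L, ∫ η : GnoCoord L, (S ε).indicator (fun _ => (1 : ℝ)) (a, η) *
        Real.exp (-(b * gnoDeficit (fun _ => false) (fun _ => 1) a ε η)) * gnoDensity η) ≤
      ∑ _ε : GnoSign L, ∫ η : GnoCoord L, Real.exp (-(b * s₀)) * gnoDensity η := by
    filter_upwards [ae_ne_zero_coneMeasure] with a ha
    refine Finset.sum_le_sum fun ε _ => ?_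
    refine integral_mono_of_nonneg (ae_of_all _ fun η => ?_) (integrable_gnoDensity.const_mul _) (ae_of_all _ fun η => hpt ε a η ha)
    exact mul_nonneg (mul_nonneg (Set.indicator_nonneg (fun _ _ => zero_le_one) _) (Real.exp_pos _).le) (gnoDensity_pos η).le
  have hint := integrable_sum_fibre (L := L) (fun _ => false) (fun _ => (1 : SU2)) (b := b)
    (g := fun ε q => (S ε).indicator (fun _ => (1 : ℝ)) q) (fun ε => ((measurable_const.indicator (hS ε))).aemeasurable) (M := 1)
    (fun ε q => by
      rw [abs_of_nonneg (Set.indicator_nonneg (fun _ _ => zero_le_one) _)]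
      exact Set.indicator_le_self' (fun _ _ => zero_le_one) _) hb
  have hmono := integral_mono_ae hint (integrable_const _) hfib
  rw [integral_const, probReal_univ, one_smul] at hmono
  calc _ ≤ (coneConst ^ 3 / 64 * (1 / (2 * Real.pi ^ 2)) ^ Fintype.card (Fol L)) *
        ∑ _ε : GnoSign L, ∫ η : GnoCoord L, Real.exp (-(b * s₀)) * gnoDensity η := mul_le_mul_of_nonneg_left hmono hK
    _ = Real.exp (-(b * s₀)) * ((coneConst ^ 3 / 64 * (1 / (2 * Real.pi ^ 2)) ^ Fintype.card (Fol L)) *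
        ∑ _ε : GnoSign L, ∫ η : GnoCoord L, gnoDensity η) := by
        simp only [integral_const_mul, ← Finset.mul_sum]; ring
    _ = Real.exp (-(b * s₀)) := by rw [gnomonic_total_mass_real one_central, mul_one]

/-- ★★ **RELATIVE SHARE, exponential form**: the same sets have share `≤ exp(−b·s₀ + (9L⁴−1)·log b + K·L⁴·(1+log L))·Z₀(b)` for EVERY `L` and `b ≥ β₀`
(ABSOLUTE `K, β₀` of ✓`swap_laplace_floor_uniform`) — negligible on a steep window as soon as `b·s₀ ≫ L⁴ log b`. [cite: Griffiths1964] [cite: Luscher1983, §2] -/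
theorem chartTerm_indicator_le_exp_mul_laplace :
    ∃ K : ℝ, 0 ≤ K ∧ ∃ β₀ : ℝ, 1 ≤ β₀ ∧ ∀ (L : ℕ) [NeZero L] (b : ℝ), β₀ ≤ b → ∀ (s₀ : ℝ) (S : GnoSign L → Set (ℍ × GnoCoord L)),
      (∀ ε, MeasurableSet (S ε)) →
      (∀ (ε : GnoSign L) (a : ℍ) (η : GnoCoord L), a ≠ 0 → (a, η) ∈ S ε → s₀ ≤ gnoDeficit (fun _ => false) (fun _ => 1) a ε η) →
      (coneConst ^ 3 / 64 * (1 / (2 * Real.pi ^ 2)) ^ Fintype.card (Fol L)) *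
          ∫ a, (∑ ε : GnoSign L, ∫ η : GnoCoord L, (S ε).indicator (fun _ => (1 : ℝ)) (a, η) *
            Real.exp (-(b * gnoDeficit (fun _ => false) (fun _ => 1) a ε η)) * gnoDensity η) ∂coneMeasure ≤
        Real.exp (-(b * s₀) + ((9 * (L : ℝ) ^ 4 - 1) * Real.log b + K * (L : ℝ) ^ 4 * (1 + Real.log L))) *
          ∫ q, Real.exp (-(b * swapRingDeficit L (fun _ => false) q)) ∂(ringMeasure L) := by
  obtain ⟨K, hK, β₀, hβ₀, hfl⟩ := swap_laplace_floor_uniform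
  refine ⟨K, hK, β₀, hβ₀, fun L _ b hb s₀ S hS hfloor => ?_⟩
  have hb0 : 0 ≤ b := by linarith
  have h1 := chartTerm_indicator_le_exp (L := L) (S := S) hS hfloor hb0
  have h2 := hfl L b hb
  -- `e^{−bs₀} = e^{−bs₀ + A}·e^{−A} ≤ e^{−bs₀ + A}·Z₀`
  calc _ ≤ Real.exp (-(b * s₀)) := h1
    _ = Real.exp (-(b * s₀) + ((9 * (L : ℝ) ^ 4 - 1) * Real.log b + K * (L : ℝ) ^ 4 * (1 + Real.log L))) *
          Real.exp (-((9 * (L : ℝ) ^ 4 - 1) * Real.log b + K * (L : ℝ) ^ 4 * (1 + Real.log L))) := by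
        rw [← Real.exp_add]; congr 1; ring
    _ ≤ _ := mul_le_mul_of_nonneg_left h2 (Real.exp_pos _).le

/-- ★★ **RELATIVE SHARE, every power**: ABSOLUTE `C > 0`, `β₁ ≥ 1` with, for EVERY `L`, `b ≥ β₁`, `s₀ > 0`, `p > 0` and measurable `S ε ⊆ {s₀ ≤ F̂₀}`
(off the null hub): `K_L·∫_cone Σ_ε ∫ 𝟙_{S ε}·e^{−bF̂₀}·ρ ≤ e·(C·p·L⁴·(1 + log L + log b)/(b·s₀))^p·Z₀(b)` (the socket ✓`chartTerm_rpow_apriori` with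
`𝟙_S ≤ (F̂₀/s₀)^p`). [cite: Griffiths1964] [cite: Luscher1983, §2] -/
theorem chartTerm_indicator_le_rpow :
    ∃ C : ℝ, 0 < C ∧ ∃ β₁ : ℝ, 1 ≤ β₁ ∧ ∀ (L : ℕ) [NeZero L] (b : ℝ), β₁ ≤ b → ∀ (s₀ : ℝ), 0 < s₀ → ∀ (p : ℝ), 0 < p →
      ∀ (S : GnoSign L → Set (ℍ × GnoCoord L)), (∀ ε, MeasurableSet (S ε)) →
      (∀ (ε : GnoSign L) (a : ℍ) (η : GnoCoord L), a ≠ 0 → (a, η) ∈ S ε → s₀ ≤ gnoDeficit (fun _ => false) (fun _ => 1) a ε η) →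
      (coneConst ^ 3 / 64 * (1 / (2 * Real.pi ^ 2)) ^ Fintype.card (Fol L)) *
          ∫ a, (∑ ε : GnoSign L, ∫ η : GnoCoord L, (S ε).indicator (fun _ => (1 : ℝ)) (a, η) *
            Real.exp (-(b * gnoDeficit (fun _ => false) (fun _ => 1) a ε η)) * gnoDensity η) ∂coneMeasure ≤
        Real.exp 1 * (C * p * (L : ℝ) ^ 4 * (1 + Real.log L + Real.log b) / (b * s₀)) ^ p *
          ∫ q, Real.exp (-(b * swapRingDeficit L (fun _ => false) q)) ∂(ringMeasure L) := by
  obtain ⟨C, hC, β₁, hβ₁, h⟩ := chartTerm_rpow_apriori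
  refine ⟨C, hC, β₁, hβ₁, fun L _ b hb s₀ hs₀ p hp S hS hfloor => ?_⟩
  have hb1 : 1 ≤ b := hβ₁.trans hb
  have hL1 : (1 : ℝ) ≤ L := by exact_mod_cast NeZero.one_le
  -- `𝟙_S ≤ s₀^{−p}·F̂^p` off the null hub
  have hle : ∀ (ε : GnoSign L) (a : ℍ) (η : GnoCoord L), a ≠ 0 →
      (S ε).indicator (fun _ => (1 : ℝ)) (a, η) ≤ s₀ ^ (-p) * gnoDeficit (fun _ => false) (fun _ => 1) a ε η ^ p := by
    intro ε a η ha
    have hF0 := gnoDeficit_nonneg (fun _ => false) (fun _ => (1 : SU2)) a ε η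
    by_cases hm : (a, η) ∈ S ε
    · rw [Set.indicator_of_mem hm]
      have hsF := hfloor ε a η ha hm
      rw [Real.rpow_neg hs₀.le, ← div_eq_inv_mul, ← Real.div_rpow hF0 hs₀.le]
      exact Real.one_le_rpow ((one_le_div hs₀).2 hsF) hp.le
    · rw [Set.indicator_of_notMem hm]; positivity
  have h1 := h L b hb p hp (s₀ ^ (-p)) (Real.rpow_nonneg hs₀.le _) 1 (fun ε q => (S ε).indicator (fun _ => (1 : ℝ)) q)
    (fun ε => measurable_const.indicator (hS ε))
    (fun ε q => by
      rw [abs_of_nonneg (Set.indicator_nonneg (fun _ _ => zero_le_one) _)]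
      exact Set.indicator_le_self' (fun _ _ => zero_le_one) _)
    (fun ε a η ha => hle ε a η ha)
  refine h1.trans (le_of_eq ?_)
  have e : (C * p * (L : ℝ) ^ 4 * (1 + Real.log L + Real.log b) / (b * s₀)) ^ p =
      s₀ ^ (-p) * (C * p * (L : ℝ) ^ 4 * (1 + Real.log L + Real.log b) / b) ^ p := by
    rw [show C * p * (L : ℝ) ^ 4 * (1 + Real.log L + Real.log b) / (b * s₀) =
      (C * p * (L : ℝ) ^ 4 * (1 + Real.log L + Real.log b) / b) / s₀ by rw [div_div],
      Real.div_rpow ?_ hs₀.le, Real.rpow_neg hs₀.le, div_eq_inv_mul]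
    have := Real.log_nonneg hL1; have := Real.log_nonneg hb1
    positivity
  rw [e]; ring

end Share

end Summit.QuantumFields.YangMills.Theorems.SwapVirialDeficit.BlowUpRing

end
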